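import Literature.NumberTheory.Weil1964.ArchUnitaryWeilHalf
import Literature.NumberTheory.Weil1964.ArchFollandDualPairDefinitePlace
import HarnessLib

/-!
# Folland's quotient character of the archimedean section: `quot (archWeilSectionS g) = ∏_v (det g_{w(v)})⁻¹`

Topic `NumberTheory/Weil1964`; namespace `Literature.NumberTheory.Weil1964`.  KERNEL MATHEMATICS ONLY: proved theorems;
no definition, no `def … : Prop` record, no axiom, no proof hole.

Sequel of `ArchUnitaryWeilHalf`.  Folland's quotient character `quot : Mp^𝓢 → ℂˣ` (`ArchMetaplecticQuotientCharacter`,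
`quot w = vac(w)² · det P(π w)`, trivial exactly on the metaplectic group [Folland1989, Thm (4.37)]) of the
`det^{1/2}`-normalised unitary section ([Paul1998, (1.2.1)]; `vac_sq_mul_det_follandP_weilElt` of
`ArchMetaplecticUnitarySplitting`) is `(det g)⁻¹` on `U(p, q)` (`UnitaryWeil.quot_weilElt`), is invariant under relabelling
(`MpS.quot_reindex`) and multiplicative over the block-diagonal assembly over the real places (`UForm.det_mat_placeDiag`);
hence **`quot_archWeilSectionS`**: `quot (archWeilSectionS g) = ∏_{v real} (det g_{w(v)})⁻¹` — the handle on the unitary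
part `χ(det)` of the Siegel-parabolic normalisation of the doubled Weil representation ([GelbartRogawski1991, §3.1];
[HarrisKudlaSweet1996, §1]).

## References

* [Folland1989] G. B. Folland, *Harmonic Analysis in Phase Space*, Princeton UP 1989, §4.2 (4.36)–(4.37), §1.3 (1.25).
* [Paul1998] A. Paul, J. Funct. Anal. 159 (1998), §1.2 (1.2.1).
* [KonnoKonno2007] K. Konno, T. Konno, Kyushu J. Math. 61 (2007), §3.1.
* [GelbartRogawski1991] S. Gelbart, J. Rogawski, Invent. math. 105 (1991), §3.1 p. 454.
-/

set_option autoImplicit false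

noncomputable section

open scoped Matrix Real Classical ComplexConjugate Kronecker
open Complex NumberField NumberField.InfinitePlace NumberField.mixedEmbedding IsDedekindDomain
open Literature.NumberTheory.Automorphic Literature.NumberTheory.Automorphic.UnitaryGroup
open Literature.RepresentationTheory.HeisenbergGroup Literature.Analysis.SegalBargmann
open Literature.RepresentationTheory.KonnoKonno2007 Literature.RepresentationTheory.KonnoKonno2007.RealDualPair

namespace Literature.NumberTheory.Weil1964

open MpS UnitaryWeil

/-! ## §1 The quotient character of the archimedean section -/

section Quot

variable {σ₁ σ₂ : Type*} [Fintype σ₁] [DecidableEq σ₁] [Fintype σ₂] [DecidableEq σ₂]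

/-- Folland's quotient value is invariant under relabelling: `quot (reindex E x) = quot x`.
[cite: Folland1989, §4.2 (4.36)–(4.37)] -/
theorem MpS.quot_reindex (E : σ₁ ≃ σ₂) (x : MpS σ₂) : MpS.quot (MpS.reindex E x) = MpS.quot x := by
  rw [MpS.quot, MpS.quot, MpS.vac_reindex]
  have h : MpS.proj (MpS.reindex E x) = reindexSp E (MpS.proj x) := rfl
  rw [h, Sp.det_follandP_reindexSp]

variable {α β : Type} [Fintype α] [DecidableEq α] [Fintype β] [DecidableEq β]

/-- **`quot (weilElt G) = (det G)⁻¹`** (`C(weilElt G)² det P(toSp G) = (det G)⁻¹`).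
[cite: Folland1989, §4.2 (4.36)–(4.37); Paul1998, §1.2 (1.2.2)] -/
theorem UnitaryWeil.quot_weilElt (G : UForm α β) : MpS.quot (weilElt G) = ((UnitaryBall.mat G).det)⁻¹ := by
  rw [MpS.quot, proj_weilElt]
  exact vac_sq_mul_det_follandP_weilElt G

/-- the determinant of `g ⊗ 1₁` is `det g`. [cite: KonnoKonno2007, §3.1 (3.1)] -/
theorem det_mat_toBig_inl_one (g : UForm α β) :
    (UnitaryBall.mat (toBig α β Unit Empty (g, 1))).det = (UnitaryBall.mat g).det := by
  rw [UnitaryBall.mat, UnitaryBall.mat, toBig_inl_one, UForm.coe_relabel, Matrix.reindex_apply,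
    Matrix.det_submatrix_equiv_self]

/-- **`quot (weilHomV α β 1 ∅ g) = (det g)⁻¹`.** [cite: Folland1989, §4.2 (4.36)–(4.37); Paul1998, §1.2 (1.2.2)] -/
theorem UnitaryWeil.quot_weilHomV_unit (g : UForm α β) :
    MpS.quot (weilHomV α β Unit Empty g) = ((UnitaryBall.mat g).det)⁻¹ := by
  rw [weilHomV_apply, UnitaryWeil.quot_weilElt]
  exact congrArg (fun x : ℂ => x⁻¹) (det_mat_toBig_inl_one g)

variable {ι o : Type} [Fintype ι] [DecidableEq ι] [Fintype o] [DecidableEq o] {P Q : o → Type} [∀ v, Fintype (P v)]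
  [∀ v, DecidableEq (P v)] [∀ v, Fintype (Q v)] [∀ v, DecidableEq (Q v)]

omit [Fintype ι] [DecidableEq ι] [Fintype o] [∀ v, Fintype (P v)] [∀ v, DecidableEq (P v)] [∀ v, Fintype (Q v)]
  [∀ v, DecidableEq (Q v)] in
/-- in the frames `ε_v : ι ≃ P_v ⊕ Q_v` the block-diagonal matrix is Mathlib's `blockDiagonal`. [cite: Weil1964, Chap. III n° 37] -/
theorem placeDiagMatrix_submatrix_placeSumIdx (ε : ∀ v, ι ≃ P v ⊕ Q v) (G : ∀ v, Matrix (P v ⊕ Q v) (P v ⊕ Q v) ℂ) :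
    (placeDiagMatrix G).submatrix (placeSumIdx ε) (placeSumIdx ε) =
      Matrix.blockDiagonal fun v => (G v).submatrix (ε v) (ε v) := by
  ext ⟨j, v⟩ ⟨j', v'⟩
  rw [Matrix.submatrix_apply, placeSumIdx_apply, placeSumIdx_apply, Matrix.blockDiagonal_apply']
  by_cases h : v = v'
  · subst h
    rw [if_pos rfl, placeDiagMatrix_apply_same, Matrix.submatrix_apply]
  · rw [if_neg h, placeDiagMatrix_apply_ne G h]

omit [DecidableEq ι] in
/-- the block-diagonal matrix has determinant `∏_v det G_v` (read in frames `ε_v : ι ≃ P_v ⊕ Q_v`).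
[cite: Weil1964, Chap. III n° 37] -/
theorem det_placeDiagMatrix (ε : ∀ v, ι ≃ P v ⊕ Q v) (G : ∀ v, Matrix (P v ⊕ Q v) (P v ⊕ Q v) ℂ) :
    (placeDiagMatrix G).det = ∏ v, (G v).det := by
  rw [← Matrix.det_submatrix_equiv_self (placeSumIdx ε) (placeDiagMatrix G), placeDiagMatrix_submatrix_placeSumIdx,
    Matrix.det_blockDiagonal]
  exact Finset.prod_congr rfl fun v _ => Matrix.det_submatrix_equiv_self _ _

omit [DecidableEq ι] in
/-- `det (placeDiag G) = ∏_v det G_v`. [cite: Weil1964, Chap. III n° 37] -/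
theorem UForm.det_mat_placeDiag (ε : ∀ v, ι ≃ P v ⊕ Q v) (G : ∀ v, UForm (P v) (Q v)) :
    (UnitaryBall.mat (UForm.placeDiag G)).det = ∏ v, (UnitaryBall.mat (G v)).det :=
  det_placeDiagMatrix ε fun v => UnitaryBall.mat (G v)

end Quot

section QuotArch

variable {F : Type} [Field F] [NumberField F] (E : Type) [Field E] [NumberField E] [Algebra F E] (c : E ≃ₐ[F] E)
  (N : ℕ) (hc : c ≠ 1)
  (wOf : {v : InfinitePlace F // v.IsReal} → {w : InfinitePlace E // w.IsComplex})
  (hw : ∀ v, c • (wOf v).1 = (wOf v).1) (hover : ∀ v, (wOf v).1.comap (algebraMap F E) = v.1)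
  (t₀ : Fin N → F) (ht0 : ∀ j, t₀ j ≠ 0) {T : Matrix (Fin N) (Fin N) F} (hTd : T = Matrix.diagonal t₀)
  {J : Matrix (Fin N) (Fin N) E} (hJ : J = T.map (algebraMap F E)) {δ : E} (hcδ : c δ = -δ) (hδ : δ ≠ 0)

/-- the determinant of the `v`-component in the sign frame is `det g_{w(v)}`. [cite: KonnoKonno2007, §3.1; Folland1989, §1.3 (1.25)] -/
theorem det_mat_archUFormPi (g : UnitaryGroup.arch F E c N J) (v : {v : InfinitePlace F // v.IsReal}) :
    (UnitaryBall.mat (archUFormPi E c N hc wOf hw hover t₀ ht0 hTd hJ hcδ hδ g v)).det =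
      (((archAt F E c N J (wOf v) (hw v) hc g : archLocal E N J (wOf v)) : GL (Fin N) ℂ) : Matrix (Fin N) (Fin N) ℂ).det := by
  rw [UnitaryBall.mat, archUFormPi_apply, coe_archUForm, Matrix.reindex_apply, Matrix.det_submatrix_equiv_self,
    det_scaleConj _ (sqrtAbs_signVec_ne_zero hc hw hcδ hδ ht0 v), archPart_archToAdelic]

/-- **THE QUOTIENT CHARACTER OF THE ARCHIMEDEAN SECTION**: `quot (archWeilSectionS g) = ∏_v (det g_{w(v)})⁻¹`, the
product over the real places of `F` of the inverse determinants of the components `g_w ∈ U(J_w)(ℂ)`.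
[cite: Folland1989, §4.2 Thm. (4.37); Paul1998, §1.2 (1.2.2); Kudla1994, §3] -/
theorem quot_archWeilSectionS (g : UnitaryGroup.arch F E c N J) :
    MpS.quot (archWeilSectionS E c N hc wOf hw hover t₀ ht0 hTd hJ hcδ hδ g) =
      ∏ v : {v : InfinitePlace F // v.IsReal},
        ((((archAt F E c N J (wOf v) (hw v) hc g : archLocal E N J (wOf v)) : GL (Fin N) ℂ) :
          Matrix (Fin N) (Fin N) ℂ).det)⁻¹ := by
  have h := UnitaryWeil.quot_weilHomV_unit (α := Σ v, PosIdx (signVec wOf t₀ δ v)) (β := Σ v, NegIdx (signVec wOf t₀ δ v))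
    (UForm.placeDiag (archUFormPi E c N hc wOf hw hover t₀ ht0 hTd hJ hcδ hδ g))
  have h2 : ((UnitaryBall.mat (UForm.placeDiag (archUFormPi E c N hc wOf hw hover t₀ ht0 hTd hJ hcδ hδ g))).det)⁻¹ =
      ∏ v : {v : InfinitePlace F // v.IsReal},
        ((((archAt F E c N J (wOf v) (hw v) hc g : archLocal E N J (wOf v)) : GL (Fin N) ℂ) :
          Matrix (Fin N) (Fin N) ℂ).det)⁻¹ := by
    rw [UForm.det_mat_placeDiag (fun v => signSplit (signVec wOf t₀ δ v)), ← Finset.prod_inv_distrib]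
    exact Finset.prod_congr rfl fun v _ => by rw [det_mat_archUFormPi]
  rw [archWeilSectionS_apply, MpS.quot_reindex, ← h2]
  -- the `Fintype`/`DecidableEq` instance terms of the block index types differ syntactically; `convert` closes them
  convert h using 2

end QuotArch

end Literature.NumberTheory.Weil1964

end
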